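import Summits.Parity.GeneralizedHardyLittlewood.Theorems.LeeYangFibresRelativeDimOneTypeDefs
import HarnessLib

/-!
# Type-class moments: elementary tools (crux stmt-Parity-14113 `LeeYangFibres.RelativeDimOne`, line
gallagher-backwards-split, RESHAPED type-conditioned split; aux for stub `stub_typeClassMoments`, part D)

Prime-free bookkeeping used by the final assembly of `stub_typeClassMoments`:
* `prod_mul_div_const`, `prod_div_const`: `∏_i (c Y_i/φ) = c^t ∏ Y_i / φ^t`;
* `toNat_cast_real`, `window_heights`: the two heights `lo = a n + u − 1`, `hi = a n + u + X` of a moving window as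
  naturals (`Int.toNat`) and reals;
* `abs_sum_sub_le`: summing a uniform bound over the positions `n < W`;
* `error_shape_le`: the real inequality turning the expansion bound's error `2^t(ρP+ρV) ∏B · K + 2^t ρJ ∏B · #cell`
  into the target shape `ε ∏Y (K/φ^t + #cell/q^t)` under the threshold inequalities;
* `typeClassMoments_of_neg` (registered hook): `TypeClassMoments θ` is vacuous for `θ < 0` (`1 ≤ q ≤ N^θ < 1`).
-/

noncomputable section

open scoped BigOperators Classical
open Finset

namespace Summit.Parity.GeneralizedHardyLittlewood.Cruxes.RelativeDimOne.TypeSplit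

namespace TCM

/-- `∏_i (c Y_i / φ) = c^t ∏ Y_i / φ^t`. -/
theorem prod_mul_div_const {t : ℕ} (c φ : ℝ) (Y : Fin t → ℝ) :
    ∏ i, (c * Y i / φ) = c ^ t * (∏ i, Y i) / φ ^ t := by
  rw [Finset.prod_div_distrib, Finset.prod_mul_distrib, Finset.prod_const, Finset.prod_const,
    Finset.card_univ, Fintype.card_fin]

/-- `∏_i (Y_i / φ) = ∏ Y_i / φ^t`. -/
theorem prod_div_const {t : ℕ} (φ : ℝ) (Y : Fin t → ℝ) : ∏ i, (Y i / φ) = (∏ i, Y i) / φ ^ t := by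
  rw [Finset.prod_div_distrib, Finset.prod_const, Finset.card_univ, Fintype.card_fin]

/-- The real cast of `z.toNat` for `z ≥ 0`. -/
theorem toNat_cast_real {z : ℤ} (hz : 0 ≤ z) : ((z.toNat : ℕ) : ℝ) = (z : ℝ) := by
  rw [← Int.cast_natCast, Int.toNat_of_nonneg hz]

/-- THE TWO HEIGHTS OF A MOVING WINDOW. For an integer `z` (think `a n + u`) with `δN + 1 ≤ z` and
`z + X ≤ LN ≤ L'N`: the naturals `lo = (z − 1).toNat`, `hi = (z + X).toNat` satisfy `lo ≤ hi`, `δN ≤ lo ≤ hi ≤ L'N`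
and `hi − lo = X + 1` (as reals). -/
theorem window_heights {z : ℤ} {X : ℕ} {δ N L L' : ℝ} (hδN : 0 ≤ δ * N) (hN : 0 ≤ N) (hLL : L ≤ L')
    (h1 : δ * N + 1 ≤ (z : ℝ)) (h2 : ((z + X : ℤ) : ℝ) ≤ L * N) :
    (z - 1).toNat ≤ (z + X).toNat ∧ δ * N ≤ (((z - 1).toNat : ℕ) : ℝ) ∧
      (((z + X).toNat : ℕ) : ℝ) ≤ L' * N ∧
      (((z + X).toNat : ℕ) : ℝ) - (((z - 1).toNat : ℕ) : ℝ) = (X : ℝ) + 1 := by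
  have hz1 : (1 : ℤ) ≤ z := by
    have : (1 : ℝ) ≤ (z : ℝ) := by linarith
    exact_mod_cast this
  have hX0 : (0 : ℤ) ≤ X := Int.natCast_nonneg X
  have hlo : (((z - 1).toNat : ℕ) : ℝ) = (z : ℝ) - 1 := by
    rw [toNat_cast_real (by linarith)]; push_cast; ring
  have hhi : (((z + X).toNat : ℕ) : ℝ) = (z : ℝ) + X := by
    rw [toNat_cast_real (by linarith)]; push_cast; ring
  refine ⟨Int.toNat_le_toNat (by linarith), ?_, ?_, ?_⟩
  · rw [hlo]; linarith
  · rw [hhi]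
    push_cast at h2
    exact h2.trans (mul_le_mul_of_nonneg_right hLL hN)
  · rw [hlo, hhi]; ring

/-- Summing a uniform bound over the positions of the window. -/
theorem abs_sum_sub_le {W : ℕ} (f : ℕ → ℝ) (m b M' B' : ℝ) (h : ∀ n ∈ range W, |f n - m| ≤ b)
    (hm : M' = W * m) (hb : B' = W * b) : |∑ n ∈ range W, f n - M'| ≤ B' := by
  rw [hm, hb]
  have e : ∑ n ∈ range W, f n - W * m = ∑ n ∈ range W, (f n - m) := by
    rw [Finset.sum_sub_distrib, Finset.sum_const, Finset.card_range, nsmul_eq_mul]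
  rw [e]
  calc _ ≤ ∑ n ∈ range W, |f n - m| := Finset.abs_sum_le_sum_abs _ _
    _ ≤ W • b := by
        have := Finset.sum_le_card_nsmul (range W) (fun n => |f n - m|) b h
        rwa [Finset.card_range] at this
    _ = W * b := nsmul_eq_mul _ _

/-- THE ERROR SHAPES. With `ρP = 3ε₂L/(δC_b)`, `ρV = 4ε₁L²/(δ²C_b²)`, `ρJ = J₀φ/(C_bδN)` and `∏B = C_b^t ∏Y/φ^t`, the
expansion bound's error `2^t(ρP+ρV) ∏B K + 2^t ρJ ∏B cc` is at most `ε ∏Y (K/φ^t + cc/q^t)` once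
`2^t C_b^t (4ε₁L²/δ²) ≤ ε/4`, `2^t C_b^t (3ε₂L/δ) ≤ ε/4` and `2^t C_b^t (q/φ)^t q J₀ ≤ (ε/2)δN`. -/
theorem error_shape_le (t : ℕ) {q φ Cb ε ε₁ ε₂ L δ N J₀ PY K cc : ℝ} (hq : 0 < q) (hφ : 0 < φ) (hφq : φ ≤ q)
    (hCb1 : 1 ≤ Cb) (hε : 0 < ε) (hε₁ : 0 ≤ ε₁) (hε₂ : 0 ≤ ε₂) (hL : 0 ≤ L) (hδ : 0 < δ) (hN : 0 < N)
    (hJ0 : 0 ≤ J₀) (hPY : 0 ≤ PY) (hK : 0 ≤ K) (hcc : 0 ≤ cc)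
    (hJ3 : 2 ^ t * Cb ^ t * (q / φ) ^ t * q * J₀ ≤ ε / 2 * δ * N)
    (hE1 : 2 ^ t * Cb ^ t * (4 * ε₁ * L ^ 2 / δ ^ 2) ≤ ε / 4)
    (hE2 : 2 ^ t * Cb ^ t * (3 * ε₂ * L / δ) ≤ ε / 4) :
    2 ^ t * (3 * ε₂ * L / (δ * Cb) + 4 * ε₁ * L ^ 2 / (δ ^ 2 * Cb ^ 2)) * (Cb ^ t * PY / φ ^ t) * K +
        2 ^ t * (J₀ * φ / (Cb * δ * N)) * (Cb ^ t * PY / φ ^ t) * cc ≤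
      ε * PY * (K / φ ^ t + cc / q ^ t) := by
  have hCb0 : 0 < Cb := by linarith
  have hφt : 0 < φ ^ t := pow_pos hφ t
  have hqt : 0 < q ^ t := pow_pos hq t
  -- coefficient of the main-relative term
  have hc1 : 2 ^ t * (3 * ε₂ * L / (δ * Cb) + 4 * ε₁ * L ^ 2 / (δ ^ 2 * Cb ^ 2)) * Cb ^ t ≤ ε / 2 := by
    have h1 : 2 ^ t * (3 * ε₂ * L / (δ * Cb)) * Cb ^ t ≤ ε / 4 := by
      calc 2 ^ t * (3 * ε₂ * L / (δ * Cb)) * Cb ^ t = 2 ^ t * Cb ^ t * (3 * ε₂ * L / δ) / Cb := by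
            field_simp
        _ ≤ 2 ^ t * Cb ^ t * (3 * ε₂ * L / δ) := div_le_self (by positivity) hCb1
        _ ≤ ε / 4 := hE2
    have h2 : 2 ^ t * (4 * ε₁ * L ^ 2 / (δ ^ 2 * Cb ^ 2)) * Cb ^ t ≤ ε / 4 := by
      have hCb2 : 1 ≤ Cb ^ 2 := one_le_pow₀ hCb1
      calc 2 ^ t * (4 * ε₁ * L ^ 2 / (δ ^ 2 * Cb ^ 2)) * Cb ^ t =
          2 ^ t * Cb ^ t * (4 * ε₁ * L ^ 2 / δ ^ 2) / Cb ^ 2 := by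
            field_simp
        _ ≤ 2 ^ t * Cb ^ t * (4 * ε₁ * L ^ 2 / δ ^ 2) := div_le_self (by positivity) hCb2
        _ ≤ ε / 4 := hE1
    calc 2 ^ t * (3 * ε₂ * L / (δ * Cb) + 4 * ε₁ * L ^ 2 / (δ ^ 2 * Cb ^ 2)) * Cb ^ t =
        2 ^ t * (3 * ε₂ * L / (δ * Cb)) * Cb ^ t + 2 ^ t * (4 * ε₁ * L ^ 2 / (δ ^ 2 * Cb ^ 2)) * Cb ^ t := by
          ring
      _ ≤ ε / 4 + ε / 4 := add_le_add h1 h2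
      _ = ε / 2 := by ring
  -- coefficient of the junk term
  have hc2 : 2 ^ t * (J₀ * φ / (Cb * δ * N)) * Cb ^ t * q ^ t ≤ ε / 2 * φ ^ t := by
    have h1 : 2 ^ t * Cb ^ t * q ^ t * q * J₀ ≤ ε / 2 * δ * N * φ ^ t := by
      have := mul_le_mul_of_nonneg_right hJ3 hφt.le
      calc 2 ^ t * Cb ^ t * q ^ t * q * J₀ = 2 ^ t * Cb ^ t * (q / φ) ^ t * q * J₀ * φ ^ t := by
            rw [div_pow]; field_simp
        _ ≤ ε / 2 * δ * N * φ ^ t := this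
    have h2 : 2 ^ t * (J₀ * φ / (Cb * δ * N)) * Cb ^ t * q ^ t =
        (2 ^ t * Cb ^ t * q ^ t * φ * J₀) / (Cb * δ * N) := by
      field_simp
    rw [h2, div_le_iff₀ (by positivity)]
    calc 2 ^ t * Cb ^ t * q ^ t * φ * J₀ ≤ 2 ^ t * Cb ^ t * q ^ t * q * J₀ := by gcongr
      _ ≤ ε / 2 * δ * N * φ ^ t := h1
      _ ≤ ε / 2 * δ * N * φ ^ t * Cb := le_mul_of_one_le_right (by positivity) hCb1
      _ = ε / 2 * φ ^ t * (Cb * δ * N) := by ring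
  -- assemble
  have e1 : 2 ^ t * (3 * ε₂ * L / (δ * Cb) + 4 * ε₁ * L ^ 2 / (δ ^ 2 * Cb ^ 2)) * (Cb ^ t * PY / φ ^ t) * K +
      2 ^ t * (J₀ * φ / (Cb * δ * N)) * (Cb ^ t * PY / φ ^ t) * cc =
      (2 ^ t * (3 * ε₂ * L / (δ * Cb) + 4 * ε₁ * L ^ 2 / (δ ^ 2 * Cb ^ 2)) * Cb ^ t) * (PY * K / φ ^ t) +
        (2 ^ t * (J₀ * φ / (Cb * δ * N)) * Cb ^ t * q ^ t / φ ^ t) * (PY * cc / q ^ t) := by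
    field_simp
  have e2 : ε * PY * (K / φ ^ t + cc / q ^ t) = ε * (PY * K / φ ^ t) + ε * (PY * cc / q ^ t) := by ring
  rw [e1, e2]
  have hc2' : 2 ^ t * (J₀ * φ / (Cb * δ * N)) * Cb ^ t * q ^ t / φ ^ t ≤ ε / 2 := by
    rw [div_le_iff₀ hφt]; exact hc2
  have hA : 0 ≤ PY * K / φ ^ t := by positivity
  have hB : 0 ≤ PY * cc / q ^ t := by positivity
  have hε' : ε / 2 ≤ ε := by linarith only [hε]
  exact add_le_add ((mul_le_mul_of_nonneg_right hc1 hA).trans (mul_le_mul_of_nonneg_right hε' hA))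
    ((mul_le_mul_of_nonneg_right hc2' hB).trans (mul_le_mul_of_nonneg_right hε' hB))

/-- HOOK (registered): the vacuous case — `TypeClassMoments θ` for `θ < 0` (no modulus `1 ≤ q ≤ N^θ < 1`). -/
theorem typeClassMoments_of_neg : ∀ θ : ℝ, θ < 0 → TypeClassMoments θ := by
  intro θ hθ t L _ δ ε _ _
  refine ⟨2, fun N hN q hq _ hqN => ?_⟩
  exfalso
  have hN1 : (1 : ℝ) < N := by exact_mod_cast lt_of_lt_of_le one_lt_two hN
  have h1 : (N : ℝ) ^ θ < 1 := Real.rpow_lt_one_of_one_lt_of_neg hN1 hθ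
  have h2 : (1 : ℝ) ≤ q := by exact_mod_cast hq
  linarith

end TCM

end Summit.Parity.GeneralizedHardyLittlewood.Cruxes.RelativeDimOne.TypeSplit

end
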